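import Summits.CriticalPhenomena.CardyFormulaZ2.Theorems.CardyBoundaryCoulombGasBoundaryDefectGaussianRStubReferenceLimitPart6
import Literature.Probability.LatticeModels.CollarLegModel
import Literature.Probability.LatticeModels.DirichletGreenFunction
import Mathlib.Analysis.SpecialFunctions.Pow.Real
import Mathlib.Analysis.SpecialFunctions.Log.Basic
import Mathlib.Analysis.SpecificLimits.Basic
import HarnessLib

/-!
# Hardness certificate for crux `BoundaryDefectGaussianR` (stmt-CriticalPhenomena-14132), line
# `rainbow-monomials-in-excursion-kernels` — Stub H8: the `(2;2)` member of CANON along the lattice squares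

The registered line stub `stub_canonicalLimit` (CANON, taken as a HYPOTHESIS) asks, for every
non-degenerate leg family `(k, L, j)`, for the convergence of the Green-normalised rainbow functional
`log (‖Zins‖/‖Z‖) − Λ_{V_n}(p_n)` along the canonical bottom-row configurations
`p_n i = (⌊x_i/δ_n⌋, -⌊1/δ_n⌋₊)`, `x_i = 2(i+1)/(k+1) - 1`, of the lattice boxes
`V_n = [-⌊1/δ_n⌋₊, ⌊1/δ_n⌋₊]²`, for every mesh sequence `δ_n → 0⁺`. Here it is specialised to `k = 2`,
`L = (2, 2)`, `j = 1` and the meshes `δ_n = 1/(12(n+1))`: then `⌊1/δ_n⌋₊ = 12(n+1)`, the canonical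
configuration is exactly the pair of bottom-row points `(∓4(n+1), -12(n+1))` (injective and admissible for
every `n`, `canonical_admissible`), and the pair sum `Λ` reduces to `(1/3) log G_{V_n}(p_n 0, p_n 1)`
(charges `e = (2, -1)`). Combined with the Green asymptotics `G_{V_n}(p_n 0, p_n 1)/δ_n² → K > 0` and the
eventual positivity of the rainbow ratio this gives `δ_n^{-2/3} ‖Zins‖/‖Z‖ → e^ℓ K^{1/3} > 0`, by the identity
`δ^{-2/3} r = exp ((log r - (1/3) log G) + (1/3) log (G/δ²))`.

* `canon22_pairSum` — the pair sum of CANON at `(2, (2,2), 1)` is `(1/3) ·` the `(0,1)` term;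
* `canon22_limit` — the real-analysis step (`log r_n - (1/3) log G_n → ℓ`, `G_n/δ_n² → K > 0`, `r_n > 0`
  eventually ⟹ `δ_n^{-2/3} r_n → exp (ℓ + (1/3) log K)`);
* `canon22_mesh` — `δ_n > 0`, `δ_n → 0`, `⌊1/δ_n⌋₊ = 12(n+1)` and the two canonical abscissae;
* `h19_canon22` (registered sub-goal H8).

All [folklore] glue over landed theorems; no new objects.
-/

noncomputable section

namespace Summit.CriticalPhenomena.CardyFormulaZ2.Cruxes.BoundaryDefectGaussianR.RainbowMonomialsInExcursionKernels

open Filter Topology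
open Literature.Probability.LatticeModels Literature.Probability.LatticeModels.CollarLegModel

/-! ### The pair sum of CANON at `k = 2`, `L = (2, 2)`, `j = 1` -/

/-- In `Fin 2`, the indices above `0` are `{1}`. [folklore] -/
theorem canon22_filter_zero_lt : Finset.univ.filter (fun i₂ : Fin 2 ↦ (0 : Fin 2) < i₂) = {1} := by decide

/-- In `Fin 2`, no index lies above `1`. [folklore] -/
theorem canon22_filter_one_lt : Finset.univ.filter (fun i₂ : Fin 2 ↦ (1 : Fin 2) < i₂) = ∅ := by decide

/-- **The pair sum of CANON at `(2, (2,2), 1)`.** With charges `e i = if i = 1 then 1 - L 1 else L i`,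
`L = (2, 2)`, i.e. `e = (2, -1)`, the sum over pairs `i₁ < i₂` of `(-(e i₁ e i₂)/6) g i₁ i₂` is
`(1/3) g 0 1`. [folklore] -/
theorem canon22_pairSum (g : Fin 2 → Fin 2 → ℝ) :
    ∑ i₁ : Fin 2, ∑ i₂ ∈ Finset.univ.filter (fun i₂ : Fin 2 ↦ i₁ < i₂),
      (-((if i₁ = (1 : Fin 2) then (1 - ((![2, 2] : Fin 2 → ℕ) 1 : ℝ)) else ((![2, 2] : Fin 2 → ℕ) i₁ : ℝ)) *
        (if i₂ = (1 : Fin 2) then (1 - ((![2, 2] : Fin 2 → ℕ) 1 : ℝ)) else ((![2, 2] : Fin 2 → ℕ) i₂ : ℝ))) / 6) *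
        g i₁ i₂ = 1 / 3 * g 0 1 := by
  rw [Fin.sum_univ_two, canon22_filter_zero_lt, canon22_filter_one_lt, Finset.sum_singleton,
    Finset.sum_empty, add_zero, if_neg (by decide), if_pos rfl]
  simp only [Matrix.cons_val_zero, Matrix.cons_val_one, Nat.cast_ofNat]
  norm_num

/-! ### The real-analysis step -/

/-- **From the Green-normalised limit to the `δ^{-2/3}` asymptotics.** If `log r_n - (1/3) log G_n → ℓ`,
`G_n / δ_n² → K > 0`, `δ_n > 0` and `r_n > 0` eventually, then `δ_n^{-2/3} r_n → exp (ℓ + (1/3) log K) > 0`: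
for large `n`, `δ_n^{-2/3} r_n = exp ((log r_n - (1/3) log G_n) + (1/3) log (G_n/δ_n²))`. [folklore] -/
theorem canon22_limit {δ r G : ℕ → ℝ} {ℓ K : ℝ} (hδ : ∀ n, 0 < δ n) (hr : ∀ᶠ n in Filter.atTop, 0 < r n)
    (hK : 0 < K) (hG : Filter.Tendsto (fun n ↦ G n / δ n ^ 2) Filter.atTop (nhds K))
    (hℓ : Filter.Tendsto (fun n ↦ Real.log (r n) - 1 / 3 * Real.log (G n)) Filter.atTop (nhds ℓ)) :
    ∃ κ : ℝ, 0 < κ ∧ Filter.Tendsto (fun n ↦ δ n ^ (-(2 / 3 : ℝ)) * r n) Filter.atTop (nhds κ) := by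
  refine ⟨Real.exp (ℓ + 1 / 3 * Real.log K), Real.exp_pos _, ?_⟩
  have hGpos : ∀ᶠ n in atTop, 0 < G n / δ n ^ 2 := hG.eventually_const_lt hK
  have hlim : Tendsto (fun n ↦ Real.exp ((Real.log (r n) - 1 / 3 * Real.log (G n)) +
      1 / 3 * Real.log (G n / δ n ^ 2))) atTop (𝓝 (Real.exp (ℓ + 1 / 3 * Real.log K))) :=
    (hℓ.add ((hG.log hK.ne').const_mul (1 / 3))).rexp
  refine hlim.congr' ?_
  filter_upwards [hr, hGpos] with n hrn hGn
  have hδ2 : 0 < δ n ^ 2 := pow_pos (hδ n) 2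
  have hGn' : 0 < G n := by
    have h := mul_pos hGn hδ2
    rwa [div_mul_cancel₀ _ hδ2.ne'] at h
  rw [Real.rpow_def_of_pos (hδ n)]
  calc Real.exp (Real.log (r n) - 1 / 3 * Real.log (G n) + 1 / 3 * Real.log (G n / δ n ^ 2))
      = Real.exp (Real.log (δ n) * -(2 / 3 : ℝ) + Real.log (r n)) := by
        congr 1
        rw [Real.log_div hGn'.ne' hδ2.ne', Real.log_pow]
        push_cast
        ring
    _ = Real.exp (Real.log (δ n) * -(2 / 3 : ℝ)) * r n := by rw [Real.exp_add, Real.exp_log hrn]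

/-! ### The meshes `δ_n = 1/(12(n+1))` and the canonical abscissae -/

/-- For `δ_n = 1/(12(n+1))`: `δ_n > 0`, `1/δ_n = 12(n+1)`, `⌊1/δ_n⌋₊ = 12(n+1)`, and the canonical
abscissae `⌊x_i/δ_n⌋`, `x_0 = -1/3`, `x_1 = 1/3`, are `∓4(n+1)`. [folklore] -/
theorem canon22_mesh {δ : ℕ → ℝ} (hδ : ∀ n, δ n = 1 / (12 * ((n : ℝ) + 1))) (n : ℕ) :
    0 < δ n ∧ 1 / δ n = ((12 * (n + 1) : ℕ) : ℝ) ∧ ⌊1 / δ n⌋₊ = 12 * (n + 1) ∧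
      ⌊(2 * (((0 : Fin 2) : ℝ) + 1) / ((2 : ℕ) + 1 : ℝ) - 1) / δ n⌋ = -(4 * ((n : ℤ) + 1)) ∧
      ⌊(2 * (((1 : Fin 2) : ℝ) + 1) / ((2 : ℕ) + 1 : ℝ) - 1) / δ n⌋ = 4 * ((n : ℤ) + 1) := by
  have hpos : 0 < δ n := by rw [hδ n]; positivity
  have hinv : 1 / δ n = ((12 * (n + 1) : ℕ) : ℝ) := by rw [hδ n, one_div_one_div]; push_cast; ring
  refine ⟨hpos, hinv, by rw [hinv, Nat.floor_natCast], ?_, ?_⟩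
  · rw [← Int.floor_intCast (R := ℝ) (-(4 * ((n : ℤ) + 1)))]
    congr 1
    rw [div_eq_mul_one_div, hinv]
    simp only [Fin.val_zero, Nat.cast_zero, Nat.cast_ofNat]
    push_cast
    ring
  · rw [← Int.floor_intCast (R := ℝ) (4 * ((n : ℤ) + 1))]
    congr 1
    rw [div_eq_mul_one_div, hinv]
    simp only [Fin.val_one, Nat.cast_one, Nat.cast_ofNat]
    push_cast
    ring

/-- `δ_n = 1/(12(n+1)) → 0`. [folklore] -/
theorem canon22_mesh_tendsto {δ : ℕ → ℝ} (hδ : ∀ n, δ n = 1 / (12 * ((n : ℝ) + 1))) :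
    Filter.Tendsto δ Filter.atTop (nhds 0) := by
  have h := (tendsto_one_div_add_atTop_nhds_zero_nat (𝕜 := ℝ)).const_mul (1 / 12)
  rw [mul_zero] at h
  refine h.congr fun n ↦ ?_
  rw [hδ n, one_div_mul_one_div]

/-! ### Stub H8 — the `(2;2)` member of CANON along the lattice squares -/

/-- **Stub H8.** The registered stub `stub_canonicalLimit` (CANON) of the line, specialised to `k = 2`, `L = (2,2)`,
`j = 1` and the meshes `δ_n = 1/(12(n+1))` (its canonical configuration is then exactly the bottom-row points
`(∓4(n+1), -12(n+1))` of the squares `[-12(n+1), 12(n+1)]²`, injective and admissible for every `n`), combined with the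
Green asymptotics of Stub H6 (`G_n/δ_n² → K > 0`): `δ_n^{-2/3} ‖Zins‖/‖Z‖ → e^ℓ K^{1/3} > 0` (the pair sum of CANON is
`(1/3) log G_n` for `e = (2, -1)`). [folklore] -/
theorem h19_canon22 : (∀ (k : ℕ) (L : Fin k → ℕ) (j : Fin k), L j = ∑ i ∈ Finset.univ.erase j, L i → (∃ i, i ≠ j) → (∀ i, i ≠ j → 1 ≤ L i) → ∃ ℓ : ℝ, ∀ (δ : ℕ → ℝ), (∀ n, 0 < δ n) → Filter.Tendsto δ Filter.atTop (nhds 0) → ∀ (V : ℕ → Finset (ℤ × ℤ)), (∀ n, ∀ v : ℤ × ℤ, v ∈ V n ↔ (-(⌊1 / δ n⌋₊ : ℤ) ≤ v.1 ∧ v.1 ≤ ⌊1 / δ n⌋₊) ∧ (-(⌊1 / δ n⌋₊ : ℤ) ≤ v.2 ∧ v.2 ≤ ⌊1 / δ n⌋₊)) → ∀ (p : ℕ → Fin k → ℤ × ℤ), (∀ n i, p n i = (⌊(2 * ((i : ℝ) + 1) / (k + 1) - 1) / δ n⌋, -(⌊1 / δ n⌋₊ : ℤ))) → (∀ n, Function.Injective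 (p n)) → (∀ n, Literature.Probability.LatticeModels.CollarLegModel.LegInsertionData.IsAdmissible (⟨(Finset.univ.erase j).image (p n), fun v ↦ ∑ b ∈ (Finset.univ.erase j).filter (fun b ↦ (p n) b = v), L b, (p n) j⟩ : Literature.Probability.LatticeModels.CollarLegModel.LegInsertionData) (V n)) → Filter.Tendsto (fun n ↦ (Real.log (‖Literature.Probability.LatticeModels.CollarLegModel.Zins (V n) (⟨(Finset.univ.erase j).image (p n), fun v ↦ ∑ b ∈ (Finset.univ.erase j).filter (fun b ↦ (p n) b = v), L b, (p n) j⟩ : Literature.Probability.LatticeModels.CollarLegModel.LegInsertionData)‖ / ‖(Literature.Probability.LatticeModels.CollarLegModel.ofDomain (V n)).Z‖) - (∑ i₁ : Fin k, ∑ i₂ ∈ Finset.univ.filter (fun i₂ : Fin k ↦ i₁ < i₂), (-((if i₁ = j then (1 - (L j : ℝ)) else (L i₁ : ℝ)) * (if i₂ = j then (1 - (L j : ℝ)) else (L i₂ : ℝ))) / 6) * Real.log (Literature.Probability.LatticeModels.dirichletGreen ((V n).image (fun v : ℤ × ℤ ↦ (![v.1, v.2] : Fin 2 → ℤ))) (![((p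 n) i₁).1, ((p n) i₁).2] : Fin 2 → ℤ) (![((p n) i₂).1, ((p n) i₂).2] : Fin 2 → ℤ))))) Filter.atTop (nhds ℓ)) →
    ∀ (δ : ℕ → ℝ) (V : ℕ → Finset (ℤ × ℤ)) (p : ℕ → Fin 2 → ℤ × ℤ),
    (∀ n, δ n = 1 / (12 * ((n : ℝ) + 1))) →
    (∀ n, ∀ v : ℤ × ℤ, v ∈ V n ↔ (-(12 * ((n : ℤ) + 1)) ≤ v.1 ∧ v.1 ≤ 12 * ((n : ℤ) + 1)) ∧
      (-(12 * ((n : ℤ) + 1)) ≤ v.2 ∧ v.2 ≤ 12 * ((n : ℤ) + 1))) →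
    (∀ n, p n 0 = (-(4 * ((n : ℤ) + 1)), -(12 * ((n : ℤ) + 1)))) →
    (∀ n, p n 1 = (4 * ((n : ℤ) + 1), -(12 * ((n : ℤ) + 1)))) →
    (∀ᶠ n in Filter.atTop, 0 < ‖Literature.Probability.LatticeModels.CollarLegModel.Zins (V n)
          (⟨(Finset.univ.erase 1).image (p n), fun v ↦ ∑ i ∈ (Finset.univ.erase 1).filter (fun i ↦ p n i = v),
            (![2, 2] : Fin 2 → ℕ) i, p n 1⟩ : Literature.Probability.LatticeModels.CollarLegModel.LegInsertionData)‖ /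
        ‖(Literature.Probability.LatticeModels.CollarLegModel.ofDomain (V n)).Z‖) →
    (∃ K : ℝ, 0 < K ∧ Filter.Tendsto (fun n ↦
      Literature.Probability.LatticeModels.dirichletGreen ((V n).image (fun v : ℤ × ℤ ↦ (![v.1, v.2] : Fin 2 → ℤ)))
        (![(p n 0).1, (p n 0).2] : Fin 2 → ℤ) (![(p n 1).1, (p n 1).2] : Fin 2 → ℤ) / (δ n) ^ 2)
      Filter.atTop (nhds K)) →
    ∃ κ : ℝ, 0 < κ ∧ Filter.Tendsto (fun n ↦ (δ n) ^ (-(2 / 3 : ℝ)) *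
      (‖Literature.Probability.LatticeModels.CollarLegModel.Zins (V n)
          (⟨(Finset.univ.erase 1).image (p n), fun v ↦ ∑ i ∈ (Finset.univ.erase 1).filter (fun i ↦ p n i = v),
            (![2, 2] : Fin 2 → ℕ) i, p n 1⟩ : Literature.Probability.LatticeModels.CollarLegModel.LegInsertionData)‖ /
        ‖(Literature.Probability.LatticeModels.CollarLegModel.ofDomain (V n)).Z‖)) Filter.atTop (nhds κ) := by
  intro hCANON δ V p hδ hVbox hp0 hp1 hposR hG
  -- the leg family `(2, (2,2), 1)` is non-degenerate
  have hsink : (![2, 2] : Fin 2 → ℕ) 1 = ∑ i ∈ Finset.univ.erase 1, (![2, 2] : Fin 2 → ℕ) i := by decide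
  have hLpos : ∀ i : Fin 2, i ≠ 1 → 1 ≤ (![2, 2] : Fin 2 → ℕ) i := by decide
  obtain ⟨ℓ, hℓ⟩ := hCANON 2 ![2, 2] 1 hsink ⟨0, by decide⟩ hLpos
  -- the meshes, the boxes and the canonical configuration
  have hδpos : ∀ n, 0 < δ n := fun n ↦ (canon22_mesh hδ n).1
  have hfloor : ∀ n, ⌊1 / δ n⌋₊ = 12 * (n + 1) := fun n ↦ (canon22_mesh hδ n).2.2.1
  have hVfloor : ∀ n, ∀ v : ℤ × ℤ, v ∈ V n ↔ (-(⌊1 / δ n⌋₊ : ℤ) ≤ v.1 ∧ v.1 ≤ ⌊1 / δ n⌋₊) ∧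
      (-(⌊1 / δ n⌋₊ : ℤ) ≤ v.2 ∧ v.2 ≤ ⌊1 / δ n⌋₊) := by
    intro n v
    rw [hVbox n v, hfloor n]
    push_cast
    exact Iff.rfl
  have hpcanon : ∀ n (i : Fin 2),
      p n i = (⌊(2 * ((i : ℝ) + 1) / ((2 : ℕ) + 1 : ℝ) - 1) / δ n⌋, -(⌊1 / δ n⌋₊ : ℤ)) := by
    intro n
    obtain ⟨-, -, hfl, h0, h1⟩ := canon22_mesh hδ n
    refine Fin.forall_fin_two.2 ⟨?_, ?_⟩
    · rw [h0, hfl, hp0 n]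
      push_cast
      exact Prod.ext rfl rfl
    · rw [h1, hfl, hp1 n]
      push_cast
      exact Prod.ext rfl rfl
  have hcan : ∀ n, Function.Injective (p n) ∧
      (⟨(Finset.univ.erase 1).image (p n), fun v ↦ ∑ b ∈ (Finset.univ.erase 1).filter (fun b ↦ (p n) b = v),
        (![2, 2] : Fin 2 → ℕ) b, (p n) 1⟩ : LegInsertionData).IsAdmissible (V n) := by
    intro n
    refine canonical_admissible 2 ![2, 2] 1 ⟨0, by decide⟩ hLpos (hδpos n) ?_ (hVfloor n) (hpcanon n)
    rw [div_eq_mul_one_div _ (δ n), (canon22_mesh hδ n).2.1, Fin.sum_univ_two]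
    simp only [Matrix.cons_val_zero, Matrix.cons_val_one]
    push_cast
    nlinarith [(n.cast_nonneg : (0 : ℝ) ≤ n)]
  have hT := hℓ δ hδpos (canon22_mesh_tendsto hδ) V hVfloor p hpcanon (fun n ↦ (hcan n).1) (fun n ↦ (hcan n).2)
  -- the Green package and the real-analysis step
  obtain ⟨K, hK, hGK⟩ := hG
  refine canon22_limit hδpos hposR hK hGK (ℓ := ℓ) ?_
  refine hT.congr fun n ↦ ?_
  rw [canon22_pairSum]

end Summit.CriticalPhenomena.CardyFormulaZ2.Cruxes.BoundaryDefectGaussianR.RainbowMonomialsInExcursionKernels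

end
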